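import Mathlib

/-!
# Tier7/Line3/LevelInvariantOrbital — the `v₁`-factor of `b_N` is an EXACT phase multiple of `b_N(γ₀)` on the level-`N` support
(seat t7-x1, gen 3; wall-breaker row for the Line-3 REPAIR CENSUS item (g2) «`b_N(γ) ≍ b_N(γ₀)` uniformly at `v₁`» —
STATUS l. 15640 (plan-3) / l. 15647 (L1-p2, (p2-6)) — both in words: «orbit map an injective immersion off the singular
cosets, Jacobian bounded on the compact `T_A γ₀ K₁ T_B`»)

LINE 3 (t7-plan-3), version (ii), the finite factors off the dominant term. The field `b_bound` of x1's `KappaData`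
(DominantSideOfKappa p677612) asks for ONE constant `Bb` with `‖b N γ‖ ≤ Bb · (1 + size γ)^ε · ‖b N γ₀‖` for EVERY level `N`
and every `γ` in the level-`N` support. At the places of `S` the local factors do not depend on `N` and x1's
CompactTorusFactorBound p678241 bounds them by the volume; at the level place `v₁` the factor `b_{v₁,N}(γ₀)` itself tends
to `0` with `N`, so a bound by the volume gives only the level-DEPENDENT constant `vol / ‖b_{v₁,N}(γ₀)‖ → ∞`: the
uniformity in `N` is exactly the in-words clause of the census. This file makes it an EXACT IDENTITY by a different
angle — ALGEBRAIC, not analytic: if the congruence subgroup `K_N` is normalized by (the image of) the torus `B` and the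
test function is right-`K_N`-invariant (the indicator of `γ₀ K_N` is), then for every `t_A ∈ A`, `t_B ∈ B`, `k ∈ K_N`

  `O_f (ι_A(t_A)⁻¹ γ₀ k ι_B(t_B)) = χ_A(t_A⁻¹) · ψ_B(t_B⁻¹) · O_f(γ₀)`,

where `O_f(γ) = ∫_A ∫_B χ_A(a) ψ_B(b) f(ι_A(a)⁻¹ γ ι_B(b))` is the twisted double orbital integral (the cell's convention
`μ_A(t) · conj μ_B(t′)` is `ψ_B = conj ∘ μ_B = μ_B⁻¹` for a unitary `μ_B`). The proof is two substitutions
`a ↦ t_A⁻¹ a`, `b ↦ t_B⁻¹ b` (`MeasureTheory.integral_mul_left_eq_self`, left-invariant measures; no finiteness and no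
integrability hypothesis — the Bochner integrals agree as stated) and the absorption of `ι_B(b)⁻¹ k ι_B(b) ∈ K_N` by the
right-invariance of `f`. Hence for unitary characters `‖O_f(γ)‖ = ‖O_f(γ₀)‖` on the WHOLE support `A γ₀ K_N B`, at EVERY
level `N` (`norm_orbital_levelTower`): the ratio is `1`, no constant, no Jacobian. Composed with the `N`-independent
factors at `S` (`‖b_S γ‖ ≤ V`, `b_S γ₀ ≠ 0`) this is `KappaData.b_bound`'s shape with a constant UNIFORM IN `N`
(`exists_b_bound_uniform`: `Bb = V / ‖b_S γ₀‖`, growth exponent `0` at `v₁`; the split places keep §2c's box count and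
DivisorBound p672115, `d′ = ε` there, unchanged).

DICTIONARY (in words, [M]-level, not distance to (P); TYPING-CENSUS T7): `G = U(W_A)(F_{v₁})` at an INERT `v₁` with
`h ∈ K_{v₁}` (almost every place qualifies), so that `T_B(F_{v₁}) ⊂ K₁` normalizes the principal congruence subgroups
`K_N ⊲ K₁`; `A = T_A(F_{v₁})`, `B = T_B(F_{v₁})` with their Haar measures; `f_{v₁,N} = 1_{γ₀ K_N}`; `χ_A = μ_{A,v₁}`,
`ψ_B = μ_{B,v₁}⁻¹`. Nothing here is about (N), (P), the real `X`, or HC_CM; §8(d): NO (a formal identity, no device).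
Blind lane: Mathlib only; no sorry; axioms ⊆ {propext, Classical.choice, Quot.sound}.
-/

namespace Summit.Ventures.HodgeRepro2.Tier7.Line3.LevelInvariantOrbital

open MeasureTheory

variable {A B G : Type*} [Group A] [Group B] [Group G]

/-! ## Cosets, right-invariance, normalization, the support -/

/-- the left coset `γ₀ K` as a set: `{g | γ₀⁻¹ g ∈ K}`. -/
def coset (γ₀ : G) (K : Subgroup G) : Set G := {g | γ₀⁻¹ * g ∈ K}

/-- membership in the coset, by definition. -/
theorem mem_coset {γ₀ : G} {K : Subgroup G} {g : G} : g ∈ coset γ₀ K ↔ γ₀⁻¹ * g ∈ K := Iff.rfl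

/-- `γ₀ ∈ γ₀ K`. -/
theorem self_mem_coset (γ₀ : G) (K : Subgroup G) : γ₀ ∈ coset γ₀ K := by
  rw [mem_coset, inv_mul_cancel]
  exact K.one_mem

/-- membership in `γ₀ K` is invariant under right multiplication by `K`. -/
theorem mul_mem_coset_iff {γ₀ : G} {K : Subgroup G} {g k : G} (hk : k ∈ K) :
    g * k ∈ coset γ₀ K ↔ g ∈ coset γ₀ K := by
  rw [mem_coset, mem_coset, ← mul_assoc]
  exact K.mul_mem_cancel_right hk

/-- `f : G → ℂ` is RIGHT-`K`-INVARIANT: `f (g k) = f g` for every `k ∈ K`. -/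
def RightInvariant (K : Subgroup G) (f : G → ℂ) : Prop := ∀ g k, k ∈ K → f (g * k) = f g

/-- the indicator of the coset `γ₀ K` (with any constant value `c`) is right-`K`-invariant. -/
theorem rightInvariant_indicator_coset (γ₀ : G) (K : Subgroup G) (c : ℂ) :
    RightInvariant K ((coset γ₀ K).indicator fun _ => c) := by
  intro g k hk
  by_cases hg : g ∈ coset γ₀ K
  · rw [Set.indicator_of_mem hg, Set.indicator_of_mem ((mul_mem_coset_iff hk).2 hg)]
  · rw [Set.indicator_of_notMem hg, Set.indicator_of_notMem (fun h => hg ((mul_mem_coset_iff hk).1 h))]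

/-- the image of `B` NORMALIZES `K`: `ι_B(b)⁻¹ k ι_B(b) ∈ K` for every `b` and every `k ∈ K`. -/
def Normalizes (ιB : B →* G) (K : Subgroup G) : Prop := ∀ b k, k ∈ K → (ιB b)⁻¹ * k * ιB b ∈ K

/-- a normal subgroup is normalized by every homomorphic image. -/
theorem normalizes_of_normal (ιB : B →* G) (K : Subgroup G) [hN : K.Normal] : Normalizes ιB K :=
  fun b k hk => by simpa using hN.conj_mem k hk (ιB b)⁻¹

/-- if `ι_B(B) ≤ K₁` and `K` is normalized by `K₁` elementwise (e.g. `K ⊲ K₁`), then `ι_B(B)` normalizes `K`. -/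
theorem normalizes_of_le (ιB : B →* G) (K K₁ : Subgroup G) (hB : ∀ b, ιB b ∈ K₁)
    (hK : ∀ x ∈ K₁, ∀ k ∈ K, x⁻¹ * k * x ∈ K) : Normalizes ιB K :=
  fun b k hk => hK (ιB b) (hB b) k hk

/-- the level SUPPORT of the geometric side at the level place: `γ ∈ ι_A(A) γ₀ K ι_B(B)`. -/
def InSupport (ιA : A →* G) (ιB : B →* G) (γ₀ : G) (K : Subgroup G) (γ : G) : Prop :=
  ∃ tA : A, ∃ tB : B, ∃ k ∈ K, γ = (ιA tA)⁻¹ * γ₀ * k * ιB tB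

/-- the dominant coset `γ₀` is in its own support. -/
theorem inSupport_self (ιA : A →* G) (ιB : B →* G) (γ₀ : G) (K : Subgroup G) :
    InSupport ιA ιB γ₀ K γ₀ :=
  ⟨1, 1, 1, K.one_mem, by simp⟩

/-- the character values of a group are units: `‖χ(t⁻¹)‖ = 1` when `‖χ‖ ≡ 1`. -/
theorem norm_map_inv_eq_one (χ : A →* ℂ) (hχ : ∀ a, ‖χ a‖ = 1) (t : A) : ‖χ t⁻¹‖ = 1 := hχ t⁻¹

/-- `χ(t⁻¹) χ(t) = 1` for a character of a group. -/
theorem map_inv_mul_self (χ : A →* ℂ) (t : A) : χ t⁻¹ * χ t = 1 := by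
  rw [← map_mul, inv_mul_cancel, map_one]

/-- scalar bookkeeping in `ℂ`: `u v = 1 ⇒ w (x y) = (u x) (v w y)`. -/
theorem aux_mul {u v w x y : ℂ} (h : u * v = 1) : w * (x * y) = u * x * (v * w * y) := by
  calc w * (x * y) = (u * v) * (w * (x * y)) := by rw [h, one_mul]
    _ = u * x * (v * w * y) := by ring

/-- scalar bookkeeping in `ℂ`: `u v = 1 ⇒ w y = u (v w y)`. -/
theorem aux_mul' {u v w y : ℂ} (h : u * v = 1) : w * y = u * (v * w * y) := by
  calc w * y = (u * v) * (w * y) := by rw [h, one_mul]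
    _ = u * (v * w * y) := by ring

/-! ## The twisted double orbital integral -/

variable [MeasurableSpace A] [MeasurableMul A] [MeasurableSpace B] [MeasurableMul B]
variable (μA : Measure A) [μA.IsMulLeftInvariant] (μB : Measure B) [μB.IsMulLeftInvariant]

/-- **the twisted double orbital integral** `O_f(γ) = ∫_A ∫_B χ_A(a) ψ_B(b) f(ι_A(a)⁻¹ γ ι_B(b))` (the cell's
`μ_A(t) conj μ_B(t′)` is `ψ_B = μ_B⁻¹` for a unitary `μ_B`). -/
noncomputable def orbital (ιA : A →* G) (ιB : B →* G) (χA : A →* ℂ) (ψB : B →* ℂ) (f : G → ℂ) (γ : G) : ℂ :=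
  ∫ a, ∫ b, χA a * ψB b * f ((ιA a)⁻¹ * γ * ιB b) ∂μB ∂μA

/-- the inner substitution `b ↦ t_B⁻¹ b`: for `k ∈ K` normalized by `ι_B(B)` and `f` right-`K`-invariant,
`∫_B ψ_B(b) f(x k ι_B(t_B) ι_B(b)) = ψ_B(t_B⁻¹) ∫_B ψ_B(b) f(x ι_B(b))`. -/
theorem integral_inner_translate (ιB : B →* G) (ψB : B →* ℂ) (K : Subgroup G) (hK : Normalizes ιB K)
    (f : G → ℂ) (hf : RightInvariant K f) (x : G) (k : G) (hk : k ∈ K) (tB : B) :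
    ∫ b, ψB b * f (x * k * ιB tB * ιB b) ∂μB = ψB tB⁻¹ * ∫ b, ψB b * f (x * ιB b) ∂μB := by
  have key : ∀ b : B, ψB b * f (x * k * ιB tB * ιB b)
      = (fun b' : B => ψB tB⁻¹ * (ψB b' * f (x * ιB b'))) (tB * b) := by
    intro b
    have hmem : (ιB (tB * b))⁻¹ * k * ιB (tB * b) ∈ K := hK (tB * b) k hk
    have hx : x * k * ιB tB * ιB b = x * (ιB tB * ιB b) * ((ιB (tB * b))⁻¹ * k * ιB (tB * b)) := by
      simp only [map_mul]
      group
    show ψB b * f (x * k * ιB tB * ιB b) = ψB tB⁻¹ * (ψB (tB * b) * f (x * ιB (tB * b)))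
    rw [hx, hf _ _ hmem, map_mul ψB, map_mul ιB]
    exact aux_mul' (map_inv_mul_self ψB tB)
  calc ∫ b, ψB b * f (x * k * ιB tB * ιB b) ∂μB
      = ∫ b, (fun b' : B => ψB tB⁻¹ * (ψB b' * f (x * ιB b'))) (tB * b) ∂μB := by
        congr 1
        ext b
        exact key b
    _ = ∫ b, (fun b' : B => ψB tB⁻¹ * (ψB b' * f (x * ιB b'))) b ∂μB :=
        integral_mul_left_eq_self (fun b' : B => ψB tB⁻¹ * (ψB b' * f (x * ιB b'))) tB
    _ = ψB tB⁻¹ * ∫ b, ψB b * f (x * ιB b) ∂μB := integral_const_mul _ _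

/-- **THE LEVEL INVARIANCE**: with `K` normalized by `ι_B(B)` and `f` right-`K`-invariant, for every `t_A ∈ A`,
`t_B ∈ B`, `k ∈ K`,
`O_f (ι_A(t_A)⁻¹ γ₀ k ι_B(t_B)) = χ_A(t_A⁻¹) · ψ_B(t_B⁻¹) · O_f(γ₀)` —
two substitutions by left-invariance and the absorption of `ι_B(b)⁻¹ k ι_B(b) ∈ K`; no integrability is assumed. -/
theorem orbital_translate (ιA : A →* G) (ιB : B →* G) (χA : A →* ℂ) (ψB : B →* ℂ) (K : Subgroup G)
    (hK : Normalizes ιB K) (f : G → ℂ) (hf : RightInvariant K f) (γ₀ : G) (tA : A) (tB : B) (k : G)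
    (hk : k ∈ K) :
    orbital μA μB ιA ιB χA ψB f ((ιA tA)⁻¹ * γ₀ * k * ιB tB)
      = χA tA⁻¹ * ψB tB⁻¹ * orbital μA μB ιA ιB χA ψB f γ₀ := by
  unfold orbital
  have key : ∀ a : A,
      (∫ b, χA a * ψB b * f ((ιA a)⁻¹ * ((ιA tA)⁻¹ * γ₀ * k * ιB tB) * ιB b) ∂μB)
        = (fun a' : A => χA tA⁻¹ * ψB tB⁻¹ *
            (χA a' * ∫ b, ψB b * f ((ιA a')⁻¹ * γ₀ * ιB b) ∂μB)) (tA * a) := by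
    intro a
    have hXY : ∀ b : B, (ιA a)⁻¹ * ((ιA tA)⁻¹ * γ₀ * k * ιB tB) * ιB b
        = (ιA (tA * a))⁻¹ * γ₀ * k * ιB tB * ιB b := by
      intro b
      simp only [map_mul, mul_inv_rev]
      group
    show _ = χA tA⁻¹ * ψB tB⁻¹ * (χA (tA * a) * ∫ b, ψB b * f ((ιA (tA * a))⁻¹ * γ₀ * ιB b) ∂μB)
    calc (∫ b, χA a * ψB b * f ((ιA a)⁻¹ * ((ιA tA)⁻¹ * γ₀ * k * ιB tB) * ιB b) ∂μB)
        = ∫ b, χA a * (ψB b * f ((ιA (tA * a))⁻¹ * γ₀ * k * ιB tB * ιB b)) ∂μB := by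
          congr 1
          ext b
          rw [hXY b, mul_assoc]
      _ = χA a * ∫ b, ψB b * f ((ιA (tA * a))⁻¹ * γ₀ * k * ιB tB * ιB b) ∂μB :=
          integral_const_mul _ _
      _ = χA a * (ψB tB⁻¹ * ∫ b, ψB b * f ((ιA (tA * a))⁻¹ * γ₀ * ιB b) ∂μB) := by
          rw [integral_inner_translate μB ιB ψB K hK f hf ((ιA (tA * a))⁻¹ * γ₀) k hk tB]
      _ = χA tA⁻¹ * ψB tB⁻¹ * (χA (tA * a) * ∫ b, ψB b * f ((ιA (tA * a))⁻¹ * γ₀ * ιB b) ∂μB) := by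
          rw [map_mul χA tA a]
          exact aux_mul (map_inv_mul_self χA tA)
  calc (∫ a, ∫ b, χA a * ψB b * f ((ιA a)⁻¹ * ((ιA tA)⁻¹ * γ₀ * k * ιB tB) * ιB b) ∂μB ∂μA)
      = ∫ a, (fun a' : A => χA tA⁻¹ * ψB tB⁻¹ *
            (χA a' * ∫ b, ψB b * f ((ιA a')⁻¹ * γ₀ * ιB b) ∂μB)) (tA * a) ∂μA := by
        congr 1
        ext a
        exact key a
    _ = ∫ a, (fun a' : A => χA tA⁻¹ * ψB tB⁻¹ *
            (χA a' * ∫ b, ψB b * f ((ιA a')⁻¹ * γ₀ * ιB b) ∂μB)) a ∂μA :=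
        integral_mul_left_eq_self (fun a' : A => χA tA⁻¹ * ψB tB⁻¹ *
            (χA a' * ∫ b, ψB b * f ((ιA a')⁻¹ * γ₀ * ιB b) ∂μB)) tA
    _ = χA tA⁻¹ * ψB tB⁻¹ * ∫ a, χA a * ∫ b, ψB b * f ((ιA a)⁻¹ * γ₀ * ιB b) ∂μB ∂μA :=
        integral_const_mul _ _
    _ = χA tA⁻¹ * ψB tB⁻¹ * ∫ a, ∫ b, χA a * ψB b * f ((ιA a)⁻¹ * γ₀ * ιB b) ∂μB ∂μA := by
        congr 1
        congr 1
        ext a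
        rw [← integral_const_mul]
        simp_rw [mul_assoc]

/-- **the norm is constant on the support** for unitary characters: `‖O_f(γ)‖ = ‖O_f(γ₀)‖` whenever
`γ ∈ ι_A(A) γ₀ K ι_B(B)`. -/
theorem norm_orbital_eq_of_inSupport (ιA : A →* G) (ιB : B →* G) (χA : A →* ℂ) (ψB : B →* ℂ)
    (hχA : ∀ a, ‖χA a‖ = 1) (hψB : ∀ b, ‖ψB b‖ = 1) (K : Subgroup G) (hK : Normalizes ιB K)
    (f : G → ℂ) (hf : RightInvariant K f) (γ₀ γ : G) (hγ : InSupport ιA ιB γ₀ K γ) :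
    ‖orbital μA μB ιA ιB χA ψB f γ‖ = ‖orbital μA μB ιA ιB χA ψB f γ₀‖ := by
  obtain ⟨tA, tB, k, hk, rfl⟩ := hγ
  rw [orbital_translate μA μB ιA ιB χA ψB K hK f hf γ₀ tA tB k hk, norm_mul, norm_mul,
    norm_map_inv_eq_one χA hχA, norm_map_inv_eq_one ψB hψB, one_mul, one_mul]

/-! ## The level tower `K_N` -/

/-- **THE LEVEL TOWER**: for subgroups `K N` each normalized by `ι_B(B)` and right-`K N`-invariant test functions
`f N` (e.g. `f N = 1_{γ₀ K N}`), the level-`N` factors `b N γ := O_{f N}(γ)` satisfy `‖b N γ‖ = ‖b N γ₀‖` for EVERY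
`N` and every `γ` in the level-`N` support — the ratio is exactly `1`, uniformly in `N`. -/
theorem norm_orbital_levelTower (ιA : A →* G) (ιB : B →* G) (χA : A →* ℂ) (ψB : B →* ℂ)
    (hχA : ∀ a, ‖χA a‖ = 1) (hψB : ∀ b, ‖ψB b‖ = 1) (K : ℕ → Subgroup G) (hK : ∀ N, Normalizes ιB (K N))
    (f : ℕ → G → ℂ) (hf : ∀ N, RightInvariant (K N) (f N)) (γ₀ : G) :
    ∀ N γ, InSupport ιA ιB γ₀ (K N) γ →
      ‖orbital μA μB ιA ιB χA ψB (f N) γ‖ = ‖orbital μA μB ιA ιB χA ψB (f N) γ₀‖ :=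
  fun N γ hγ => norm_orbital_eq_of_inSupport μA μB ιA ιB χA ψB hχA hψB (K N) (hK N) (f N) (hf N) γ₀ γ hγ

/-- the level tower with the INDICATORS `f N = 1_{γ₀ K N}`: the hypotheses reduce to the normalization. -/
theorem norm_orbital_levelTower_indicator (ιA : A →* G) (ιB : B →* G) (χA : A →* ℂ) (ψB : B →* ℂ)
    (hχA : ∀ a, ‖χA a‖ = 1) (hψB : ∀ b, ‖ψB b‖ = 1) (K : ℕ → Subgroup G) (hK : ∀ N, Normalizes ιB (K N))
    (γ₀ : G) :
    ∀ N γ, InSupport ιA ιB γ₀ (K N) γ →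
      ‖orbital μA μB ιA ιB χA ψB ((coset γ₀ (K N)).indicator fun _ => (1 : ℂ)) γ‖
        = ‖orbital μA μB ιA ιB χA ψB ((coset γ₀ (K N)).indicator fun _ => (1 : ℂ)) γ₀‖ :=
  norm_orbital_levelTower μA μB ιA ιB χA ψB hχA hψB K hK
    (fun N => (coset γ₀ (K N)).indicator fun _ => (1 : ℂ))
    (fun N => rightInvariant_indicator_coset γ₀ (K N) 1) γ₀

/-! ## Assembly with the `N`-independent factors: `b_bound` with a constant uniform in `N` -/

/-- **`b_bound` UNIFORM IN `N`**: if `b N γ = bS γ * bv N γ` with the `N`-independent part bounded (`‖bS γ‖ ≤ V`) and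
non-zero at `γ₀`, and the level part of constant norm on the support (`‖bv N γ‖ = ‖bv N γ₀‖`), then
`‖b N γ‖ ≤ (V / ‖bS γ₀‖) · ‖b N γ₀‖` for all `N` and all `γ` in the support — one constant for every level. -/
theorem b_bound_uniform {Orb : Type*} (arith : ℕ → Orb → Prop) (γ₀ : Orb) (bS : Orb → ℂ) (bv : ℕ → Orb → ℂ)
    (V : ℝ) (hV : ∀ γ, ‖bS γ‖ ≤ V) (hS₀ : bS γ₀ ≠ 0)
    (hv : ∀ N γ, arith N γ → ‖bv N γ‖ = ‖bv N γ₀‖) :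
    ∀ N γ, arith N γ → ‖bS γ * bv N γ‖ ≤ (V / ‖bS γ₀‖) * ‖bS γ₀ * bv N γ₀‖ := by
  intro N γ hγ
  have hne : ‖bS γ₀‖ ≠ 0 := (norm_pos_iff.2 hS₀).ne'
  rw [norm_mul, norm_mul, hv N γ hγ]
  calc ‖bS γ‖ * ‖bv N γ₀‖ ≤ V * ‖bv N γ₀‖ := by gcongr; exact hV γ
    _ = (V / ‖bS γ₀‖) * (‖bS γ₀‖ * ‖bv N γ₀‖) := by
        rw [← mul_assoc, div_mul_cancel₀ V hne]

/-- the same in the shape of `KappaData.b_bound` (any growth exponent `ε ≥ 0`, any non-negative size):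
`∃ Bb, ∀ N γ, arith N γ → ‖b N γ‖ ≤ Bb * (1 + size γ)^ε * ‖b N γ₀‖`, together with `b N γ₀ ≠ 0` whenever the level
factor is non-zero at `γ₀`. -/
theorem exists_b_bound_uniform {Orb : Type*} (arith : ℕ → Orb → Prop) (γ₀ : Orb) (bS : Orb → ℂ)
    (bv : ℕ → Orb → ℂ) (V : ℝ) (hV : ∀ γ, ‖bS γ‖ ≤ V) (hS₀ : bS γ₀ ≠ 0)
    (hv : ∀ N γ, arith N γ → ‖bv N γ‖ = ‖bv N γ₀‖) (size : Orb → ℝ) (hsize : ∀ γ, 0 ≤ size γ) {ε : ℝ}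
    (hε : 0 ≤ ε) :
    (∃ Bb : ℝ, ∀ N γ, arith N γ →
        ‖bS γ * bv N γ‖ ≤ Bb * (1 + size γ) ^ ε * ‖bS γ₀ * bv N γ₀‖) ∧
      (∀ N, bv N γ₀ ≠ 0 → bS γ₀ * bv N γ₀ ≠ 0) := by
  refine ⟨⟨V / ‖bS γ₀‖, fun N γ hγ => ?_⟩, fun N hN => mul_ne_zero hS₀ hN⟩
  have h1 : 1 ≤ (1 + size γ) ^ ε := Real.one_le_rpow (by linarith [hsize γ]) hε
  have hq : 0 ≤ V / ‖bS γ₀‖ :=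
    div_nonneg ((norm_nonneg _).trans (hV γ₀)) (norm_nonneg _)
  calc ‖bS γ * bv N γ‖ ≤ (V / ‖bS γ₀‖) * ‖bS γ₀ * bv N γ₀‖ :=
        b_bound_uniform arith γ₀ bS bv V hV hS₀ hv N γ hγ
    _ = (V / ‖bS γ₀‖) * 1 * ‖bS γ₀ * bv N γ₀‖ := by ring
    _ ≤ (V / ‖bS γ₀‖) * (1 + size γ) ^ ε * ‖bS γ₀ * bv N γ₀‖ := by gcongr


/-! ## Appendix (gen 3, second landing): `b_support` off the support, and the unramified places -/

omit [MeasurableMul A] [MeasurableMul B] [μA.IsMulLeftInvariant] [μB.IsMulLeftInvariant] in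
/-- **`b_support` at the level place**: off the support `ι_A(A) γ₀ K ι_B(B)` the twisted orbital integral of the coset
indicator VANISHES — the integrand is `0` at every `(a, b)`. (`KappaData.b_support : b N γ ≠ 0 → arith N γ`.) -/
theorem orbital_indicator_eq_zero_of_not_inSupport (ιA : A →* G) (ιB : B →* G) (χA : A →* ℂ) (ψB : B →* ℂ)
    (γ₀ : G) (K : Subgroup G) (γ : G) (hγ : ¬ InSupport ιA ιB γ₀ K γ) :
    orbital μA μB ιA ιB χA ψB ((coset γ₀ K).indicator fun _ => (1 : ℂ)) γ = 0 := by
  unfold orbital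
  have hzero : ∀ a b, χA a * ψB b * (coset γ₀ K).indicator (fun _ => (1 : ℂ)) ((ιA a)⁻¹ * γ * ιB b) = 0 := by
    intro a b
    have hnot : (ιA a)⁻¹ * γ * ιB b ∉ coset γ₀ K := by
      intro hmem
      apply hγ
      refine ⟨a⁻¹, b⁻¹, γ₀⁻¹ * ((ιA a)⁻¹ * γ * ιB b), hmem, ?_⟩
      simp only [map_inv, inv_inv]
      group
    rw [Set.indicator_of_notMem hnot, mul_zero]
  simp_rw [hzero]
  simp

omit [MeasurableMul A] [MeasurableMul B] [μA.IsMulLeftInvariant] [μB.IsMulLeftInvariant] in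
/-- the support condition is NECESSARY for a non-zero level factor: `b γ ≠ 0 → γ ∈ ι_A(A) γ₀ K ι_B(B)`. -/
theorem inSupport_of_orbital_indicator_ne_zero (ιA : A →* G) (ιB : B →* G) (χA : A →* ℂ) (ψB : B →* ℂ)
    (γ₀ : G) (K : Subgroup G) (γ : G)
    (h : orbital μA μB ιA ιB χA ψB ((coset γ₀ K).indicator fun _ => (1 : ℂ)) γ ≠ 0) :
    InSupport ιA ιB γ₀ K γ := by
  by_contra hγ
  exact h (orbital_indicator_eq_zero_of_not_inSupport μA μB ιA ιB χA ψB γ₀ K γ hγ)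

omit [MeasurableMul A] [MeasurableMul B] [μA.IsMulLeftInvariant] [μB.IsMulLeftInvariant] in
/-- **an UNRAMIFIED place**: with both tori inside `K` (`ι_A(A), ι_B(B) ⊆ K`), the orbital integral of `1_K` at
`γ₀ = 1` is the product of the two character integrals. -/
theorem orbital_indicator_one_of_le (ιA : A →* G) (ιB : B →* G) (χA : A →* ℂ) (ψB : B →* ℂ) (K : Subgroup G)
    (hA : ∀ a, ιA a ∈ K) (hB : ∀ b, ιB b ∈ K) :
    orbital μA μB ιA ιB χA ψB ((coset 1 K).indicator fun _ => (1 : ℂ)) 1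
      = (∫ a, χA a ∂μA) * ∫ b, ψB b ∂μB := by
  unfold orbital
  have hone : ∀ a b, χA a * ψB b * (coset 1 K).indicator (fun _ => (1 : ℂ)) ((ιA a)⁻¹ * 1 * ιB b)
      = χA a * ψB b := by
    intro a b
    have hmem : (ιA a)⁻¹ * 1 * ιB b ∈ coset 1 K := by
      rw [mem_coset, inv_one, one_mul, mul_one]
      exact K.mul_mem (K.inv_mem (hA a)) (hB b)
    rw [Set.indicator_of_mem hmem, mul_one]
  simp_rw [hone]
  rw [← integral_mul_const]
  congr 1
  ext a
  rw [integral_const_mul]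

omit [MeasurableMul A] [MeasurableMul B] [μA.IsMulLeftInvariant] [μB.IsMulLeftInvariant] in
/-- at an unramified place with TRIVIAL characters the factor at `γ₀ = 1` is the product of the volumes. -/
theorem orbital_indicator_one_of_le_of_trivial (ιA : A →* G) (ιB : B →* G) (χA : A →* ℂ) (ψB : B →* ℂ)
    (K : Subgroup G) (hA : ∀ a, ιA a ∈ K) (hB : ∀ b, ιB b ∈ K) (hχA : ∀ a, χA a = 1) (hψB : ∀ b, ψB b = 1) :
    orbital μA μB ιA ιB χA ψB ((coset 1 K).indicator fun _ => (1 : ℂ)) 1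
      = ((μA.real Set.univ : ℝ) : ℂ) * ((μB.real Set.univ : ℝ) : ℂ) := by
  rw [orbital_indicator_one_of_le μA μB ιA ιB χA ψB K hA hB]
  simp_rw [hχA, hψB]
  simp [integral_const, Complex.real_smul]

/-- **the unramified factor is CONSTANT on the support**: tori inside `K`, unitary characters — then `‖O(γ)‖ = ‖O(1)‖`
for every `γ ∈ ι_A(A) K ι_B(B)`, and `O(γ) = 0` off it (`orbital_indicator_eq_zero_of_not_inSupport`). -/
theorem norm_orbital_indicator_eq_of_le (ιA : A →* G) (ιB : B →* G) (χA : A →* ℂ) (ψB : B →* ℂ)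
    (hχA : ∀ a, ‖χA a‖ = 1) (hψB : ∀ b, ‖ψB b‖ = 1) (K : Subgroup G) (hB : ∀ b, ιB b ∈ K) (γ : G)
    (hγ : InSupport ιA ιB 1 K γ) :
    ‖orbital μA μB ιA ιB χA ψB ((coset 1 K).indicator fun _ => (1 : ℂ)) γ‖
      = ‖orbital μA μB ιA ιB χA ψB ((coset 1 K).indicator fun _ => (1 : ℂ)) 1‖ :=
  norm_orbital_eq_of_inSupport μA μB ιA ιB χA ψB hχA hψB K
    (fun b _ hk => K.mul_mem (K.mul_mem (K.inv_mem (hB b)) hk) (hB b))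
    _ (rightInvariant_indicator_coset 1 K 1) 1 γ hγ

/-- **`b_bound` with a GROWING `N`-independent part**: if the `N`-independent factor already satisfies `b_bound`'s shape
(`‖bF γ‖ ≤ C (1 + size γ)^ε ‖bF γ₀‖` on the support — the split places' box counts / DivisorBound) and the level factor has
constant norm on the support, the product satisfies the same bound with the SAME constant at every level. -/
theorem b_bound_of_levelInvariant {Orb : Type*} (arith : ℕ → Orb → Prop) (γ₀ : Orb) (bF : Orb → ℂ)
    (bv : ℕ → Orb → ℂ) (C : ℝ) (size : Orb → ℝ) (ε : ℝ)
    (hF : ∀ N γ, arith N γ → ‖bF γ‖ ≤ C * (1 + size γ) ^ ε * ‖bF γ₀‖)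
    (hv : ∀ N γ, arith N γ → ‖bv N γ‖ = ‖bv N γ₀‖) :
    ∀ N γ, arith N γ → ‖bF γ * bv N γ‖ ≤ C * (1 + size γ) ^ ε * ‖bF γ₀ * bv N γ₀‖ := by
  intro N γ hγ
  rw [norm_mul, norm_mul, hv N γ hγ, ← mul_assoc]
  exact mul_le_mul_of_nonneg_right (hF N γ hγ) (norm_nonneg _)

omit [MeasurableMul A] [MeasurableMul B] [μA.IsMulLeftInvariant] [μB.IsMulLeftInvariant] in
/-- **iterated = product** (crit-2's record (a), STATUS l. 15665): for an integrable twisted integrand the iterated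
`orbital` equals the integral over the product `A × B` (Fubini, `MeasureTheory.integral_prod`). -/
theorem orbital_eq_integral_prod [SFinite μA] [SFinite μB] (ιA : A →* G) (ιB : B →* G) (χA : A →* ℂ) (ψB : B →* ℂ)
    (f : G → ℂ) (γ : G)
    (hint : Integrable (fun p : A × B => χA p.1 * ψB p.2 * f ((ιA p.1)⁻¹ * γ * ιB p.2)) (μA.prod μB)) :
    orbital μA μB ιA ιB χA ψB f γ
      = ∫ p, χA p.1 * ψB p.2 * f ((ιA p.1)⁻¹ * γ * ιB p.2) ∂(μA.prod μB) :=
  (integral_prod _ hint).symm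

end Summit.Ventures.HodgeRepro2.Tier7.Line3.LevelInvariantOrbital
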